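import Literature.NumberTheory.DiophantineGeometry.GenEllDeCoverFarFromCuspsFamily

/-!
# [GenEll] Thm 2.1 for `ℙ¹` (route piece W7, family `t_c`, ANY FINITE SET OF PRIMES `S`):
# `φ_c = β ∘ t_c` sends points far from the fibre `E_φ` — at `∞` and at every `ℓ ∈ S` — to points
# `NFPoint.FarFromCusps S ρ'`

Support theorem for the number-field-only proof architecture of `GenEllTwo` (stmt-ABC-19679;
S. Mochizuki, *Arithmetic elliptic curves in general position*, Math. J. Okayama Univ. **52** (2010),
Thm. 2.1, proof p. 12 [cite: MochizukiGenEll2010, Thm 2.1 p.12]; package map `GENELLTWO-P1ROUTE.md`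
of seat abc-iut-S6, W7 «properness»; S6 RULING #6 «per (c, T)»; w5-d045's R-a′ INTERFACE CONTRACT
adopted by S6 (2026-08-26 01:09Z): the mechanism bookkeeping
`GenEllPhiMechanismPlaces.vojtaIneq_of_belyi_mechanism_of_subset` takes
`hZfar : (Z P).FarFromCusps S ρ'` at an ARBITRARY finite set of primes `S ⊇ {2}` (`S := S_bad(e, B)`),
so W7 is needed at every `ℓ ∈ S`, with ONE `ρ'`).

`GenEllDeCoverFarFromCuspsFamily.exists_farFromCusps_phi_c` is the case `S = {2}`; the `ℓ`-adic
argument there is prime-agnostic (Krasner finiteness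
`LocalFields.finite_setOf_intermediateField_finrank_le ℓ`, properness of `K × K` for `K/ℚ_ℓ` finite:
`exists_annulus_of_far_fibre_c_of_submodule`), and a minimum over the finite `S` gives the uniform
constant:

* `exists_farFromCusps_phi_c_places` — conjugates `(σx, σr)` `ρ`-far (sup-distance) from the
  non-pole fibre points at `∞` and at every `ℓ ∈ S` ⟹ `NFPoint.FarFromCusps S ρ'` for
  `⟨F, β(t_c(x, r))⟩`, `ρ'` uniform in `[F:ℚ] ≤ N`;
* `exists_farFromCusps_phi_c_places_of_x_far` — the same from «`σx` `ρ`-far from the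
  `x`-coordinates of the fibre points».

Conventions of `GenEllDeCoverFarFromCuspsFamily` (`2k = e + 1`, `t_c = r⁻¹ + c·r^k/(1 − 2x)`,
`c ∈ ℚ^×` cast into the field); the D3/point-indexed adapters are in
`GenEllDeCoverFarFromCuspsFamilyPlacesD3`.  Classical; nothing here bears on [IUTchIII] Cor. 3.12.
-/

namespace Literature.NumberTheory.DiophantineGeometry.GenEll

open Metric Set Polynomial NumberField

section Helpers

/-- Transport of `t_c` under a ring homomorphism of fields. [folklore] -/
private theorem map_tDeP {F L : Type*} [Field F] [CharZero F] [Field L] [CharZero L]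
    (σ : F →+* L) (c : ℚ) (x r : F) (k : ℕ) :
    σ (r⁻¹ + (c : F) * r ^ k / (1 - 2 * x)) = (σ r)⁻¹ + (c : L) * (σ r) ^ k / (1 - 2 * σ x) := by
  simp [map_add, map_inv₀, map_div₀, map_pow, map_sub, map_mul, map_ofNat, map_ratCast]

/-- Transport of `φ = β ∘ t` under a ring homomorphism of fields. [folklore] -/
private theorem map_phiDeP {F L : Type*} [Field F] [CharZero F] [Field L] [CharZero L]
    (σ : F →+* L) (p q : ℚ[X]) (y : F) :
    σ (aeval y p / aeval y q) = aeval (σ y) p / aeval (σ y) q := by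
  rw [map_div₀]
  have h : ∀ f : ℚ[X], σ (aeval y f) = aeval (σ y) f := fun f => by
    change σ.toRatAlgHom (aeval y f) = aeval (σ.toRatAlgHom y) f
    rw [aeval_algHom_apply]
  rw [h p, h q]

/-- Mapped data keep degrees and non-degeneracy (bookkeeping). [folklore] -/
private theorem mapped_hypsP {L : Type*} [Field L] [CharZero L] {p q : ℚ[X]} {n : ℕ}
    (hpn : p.natDegree = n) (hqn : q.natDegree = n) (hpqn : (p - q).natDegree = n)
    (hp0 : p ≠ 0) (hq0 : q ≠ 0) (hne : p ≠ q) :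
    (p.map (algebraMap ℚ L)).natDegree = n ∧ (q.map (algebraMap ℚ L)).natDegree = n ∧
      (p.map (algebraMap ℚ L) - q.map (algebraMap ℚ L)).natDegree = n ∧
      p.map (algebraMap ℚ L) ≠ 0 ∧ q.map (algebraMap ℚ L) ≠ 0 ∧
      p.map (algebraMap ℚ L) ≠ q.map (algebraMap ℚ L) := by
  have hinj : Function.Injective (algebraMap ℚ L) := (algebraMap ℚ L).injective
  refine ⟨by rw [natDegree_map_eq_of_injective hinj, hpn],
    by rw [natDegree_map_eq_of_injective hinj, hqn], ?_, ?_, ?_, ?_⟩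
  · rw [← Polynomial.map_sub, natDegree_map_eq_of_injective hinj, hpqn]
  · exact (Polynomial.map_ne_zero_iff hinj).mpr hp0
  · exact (Polynomial.map_ne_zero_iff hinj).mpr hq0
  · exact fun h => hne (Polynomial.map_injective _ hinj h)

/-- `aeval y f = (f.map (algebraMap ℚ L)).eval y`. [folklore] -/
private theorem aeval_eq_eval_mapP {L : Type*} [Field L] [CharZero L] (f : ℚ[X]) (y : L) :
    aeval y f = (f.map (algebraMap ℚ L)).eval y := by
  rw [eval_map, aeval_def]

/-- The fibre condition in `aeval` form vs `eval`-of-`map` form. [folklore] -/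
private theorem fibre_aeval_iffP {L : Type*} [Field L] [CharZero L] (p q : ℚ[X]) (y : L) :
    (aeval y p = 0 ∨ aeval y q = 0 ∨ aeval y (p - q) = 0) ↔
    ((p.map (algebraMap ℚ L)).eval y = 0 ∨ (q.map (algebraMap ℚ L)).eval y = 0 ∨
      (p.map (algebraMap ℚ L) - q.map (algebraMap ℚ L)).eval y = 0) := by
  rw [← Polynomial.map_sub, ← aeval_eq_eval_mapP, ← aeval_eq_eval_mapP, ← aeval_eq_eval_mapP]

/-- Finite minimum of positive witnesses (bookkeeping). [folklore] -/
private theorem exists_pos_forall_of_antitoneP {α : Type*} (B : Finset α) (Q : α → ℝ → Prop)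
    (hmono : ∀ b m m', 0 < m' → m' ≤ m → Q b m → Q b m')
    (h : ∀ b ∈ B, ∃ m : ℝ, 0 < m ∧ Q b m) : ∃ m : ℝ, 0 < m ∧ ∀ b ∈ B, Q b m := by
  classical
  induction B using Finset.induction_on with
  | empty => exact ⟨1, one_pos, by simp⟩
  | insert a B ha ih =>
    obtain ⟨m₁, hm₁, hQ₁⟩ := h a (Finset.mem_insert_self a B)
    obtain ⟨m₂, hm₂, hQ₂⟩ := ih fun b hb => h b (Finset.mem_insert_of_mem hb)
    refine ⟨min m₁ m₂, lt_min hm₁ hm₂, fun b hb => ?_⟩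
    rcases Finset.mem_insert.mp hb with rfl | hb
    · exact hmono _ _ _ (lt_min hm₁ hm₂) (min_le_left _ _) hQ₁
    · exact hmono _ _ _ (lt_min hm₁ hm₂) (min_le_right _ _) (hQ₂ b hb)

end Helpers

section OnePrime

/-- **W7 at one prime `ℓ`, uniformly in `[F:ℚ] ≤ N`** (family `t_c`, `c ∈ ℚ^×`): there is `ρK > 0`
such that for every number field `F` of degree `≤ N`, every non-pole `(x, r) ∈ D_e(F)` whose
`ℓ`-adic conjugates `(σx, σr)` are `ρ`-far from the non-pole fibre points of
`E_φ = {p(t_c) = 0} ∪ {q(t_c) = 0} ∪ {(p−q)(t_c) = 0}`, and every `σ : F →+* ℚ̄_ℓ^∧`: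
`ρK ≤ ‖σ φ‖ ≤ ρK⁻¹`, `ρK ≤ ‖σ φ − 1‖`, `φ = β(t_c(x, r))`.  (Krasner: `(σx, σr)` lies in one of the
finitely many `K = ℚ_ℓ⟮σx⟯ ⊔ ℚ_ℓ⟮σr⟯ ⊆ ℚ̄_ℓ` of degree `≤ N²`; properness of `K × K`.)
[cite: MochizukiGenEll2010, Thm 2.1 p.12] -/
theorem exists_padicAnnulus_phi_c (ℓ : ℕ) [Fact ℓ.Prime] {e k : ℕ} (he : 0 < e)
    (hk : 2 * k = e + 1) {c : ℚ} (hc : c ≠ 0) {p q : ℚ[X]} {n : ℕ} (hpn : p.natDegree = n)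
    (hqn : q.natDegree = n) (hpqn : (p - q).natDegree = n) (hp0 : p ≠ 0) (hq0 : q ≠ 0)
    (hne : p ≠ q) {ρ : ℝ} (hρ : 0 < ρ) (N : ℕ) :
    ∃ ρK : ℝ, 0 < ρK ∧
      ∀ (F : Type) [Field F] [NumberField F], Module.finrank ℚ F ≤ N →
      ∀ (x r : F), r ^ e = x * (1 - x) → r ≠ 0 → 1 - 2 * x ≠ 0 →
      (∀ σ : F →+* PadicAlgCl ℓ, ∀ P' : PadicAlgCl ℓ × PadicAlgCl ℓ,
        P'.2 ^ e = P'.1 * (1 - P'.1) → P'.2 ≠ 0 → 1 - 2 * P'.1 ≠ 0 →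
        (aeval (P'.2⁻¹ + (c : PadicAlgCl ℓ) * P'.2 ^ k / (1 - 2 * P'.1)) p = 0 ∨
          aeval (P'.2⁻¹ + (c : PadicAlgCl ℓ) * P'.2 ^ k / (1 - 2 * P'.1)) q = 0 ∨
          aeval (P'.2⁻¹ + (c : PadicAlgCl ℓ) * P'.2 ^ k / (1 - 2 * P'.1)) (p - q) = 0) →
        ρ ≤ dist ((σ x, σ r) : PadicAlgCl ℓ × PadicAlgCl ℓ) P') →
      ∀ σ : F →+* PadicAlgCl ℓ,
        ρK ≤ ‖σ (aeval (r⁻¹ + (c : F) * r ^ k / (1 - 2 * x)) p /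
            aeval (r⁻¹ + (c : F) * r ^ k / (1 - 2 * x)) q)‖ ∧
        ‖σ (aeval (r⁻¹ + (c : F) * r ^ k / (1 - 2 * x)) p /
            aeval (r⁻¹ + (c : F) * r ^ k / (1 - 2 * x)) q)‖ ≤ ρK⁻¹ ∧
        ρK ≤ ‖σ (aeval (r⁻¹ + (c : F) * r ^ k / (1 - 2 * x)) p /
            aeval (r⁻¹ + (c : F) * r ^ k / (1 - 2 * x)) q) - 1‖ := by
  classical
  haveI : IsScalarTower ℚ ℚ_[ℓ] (PadicAlgCl ℓ) := IsScalarTower.of_algebraMap_eq (fun q => by simp)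
  obtain ⟨hpn2, hqn2, hpqn2, hp02, hq02, hne2⟩ :=
    mapped_hypsP (L := PadicAlgCl ℓ) hpn hqn hpqn hp0 hq0 hne
  have hc2 : (c : PadicAlgCl ℓ) ≠ 0 := Rat.cast_ne_zero.mpr hc
  set 𝒦 : Set (IntermediateField ℚ_[ℓ] (PadicAlgCl ℓ)) :=
    {K | FiniteDimensional ℚ_[ℓ] K ∧ Module.finrank ℚ_[ℓ] K ≤ N * N} with h𝒦
  have h𝒦fin : 𝒦.Finite :=
    Literature.NumberTheory.LocalFields.finite_setOf_intermediateField_finrank_le ℓ (N * N)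
  have hperK : ∀ K ∈ h𝒦fin.toFinset, ∃ ρK : ℝ, 0 < ρK ∧ (ρK ≤ 1 ∧
      ∀ P : PadicAlgCl ℓ × PadicAlgCl ℓ, P.1 ∈ K.toSubalgebra.toSubmodule →
        P.2 ∈ K.toSubalgebra.toSubmodule → P.2 ^ e = P.1 * (1 - P.1) → P.2 ≠ 0 → 1 - 2 * P.1 ≠ 0 →
        (∀ P' : PadicAlgCl ℓ × PadicAlgCl ℓ, P'.2 ^ e = P'.1 * (1 - P'.1) → P'.2 ≠ 0 →
          1 - 2 * P'.1 ≠ 0 →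
          ((p.map (algebraMap ℚ (PadicAlgCl ℓ))).eval
              (P'.2⁻¹ + (c : PadicAlgCl ℓ) * P'.2 ^ k / (1 - 2 * P'.1)) = 0 ∨
            (q.map (algebraMap ℚ (PadicAlgCl ℓ))).eval
              (P'.2⁻¹ + (c : PadicAlgCl ℓ) * P'.2 ^ k / (1 - 2 * P'.1)) = 0 ∨
            (p.map (algebraMap ℚ (PadicAlgCl ℓ)) - q.map (algebraMap ℚ (PadicAlgCl ℓ))).eval
              (P'.2⁻¹ + (c : PadicAlgCl ℓ) * P'.2 ^ k / (1 - 2 * P'.1)) = 0) → ρ ≤ dist P P') →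
        ρK ≤ ‖(p.map (algebraMap ℚ (PadicAlgCl ℓ))).eval
              (P.2⁻¹ + (c : PadicAlgCl ℓ) * P.2 ^ k / (1 - 2 * P.1)) /
            (q.map (algebraMap ℚ (PadicAlgCl ℓ))).eval
              (P.2⁻¹ + (c : PadicAlgCl ℓ) * P.2 ^ k / (1 - 2 * P.1))‖ ∧
        ‖(p.map (algebraMap ℚ (PadicAlgCl ℓ))).eval
              (P.2⁻¹ + (c : PadicAlgCl ℓ) * P.2 ^ k / (1 - 2 * P.1)) /
            (q.map (algebraMap ℚ (PadicAlgCl ℓ))).eval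
              (P.2⁻¹ + (c : PadicAlgCl ℓ) * P.2 ^ k / (1 - 2 * P.1))‖ ≤ ρK⁻¹ ∧
        ρK ≤ ‖(p.map (algebraMap ℚ (PadicAlgCl ℓ))).eval
              (P.2⁻¹ + (c : PadicAlgCl ℓ) * P.2 ^ k / (1 - 2 * P.1)) /
            (q.map (algebraMap ℚ (PadicAlgCl ℓ))).eval
              (P.2⁻¹ + (c : PadicAlgCl ℓ) * P.2 ^ k / (1 - 2 * P.1)) - 1‖) := by
    intro K hK
    rw [Set.Finite.mem_toFinset] at hK
    haveI : FiniteDimensional ℚ_[ℓ] K.toSubalgebra.toSubmodule := hK.1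
    obtain ⟨ρK, h0, h1, h⟩ := exists_annulus_of_far_fibre_c_of_submodule (L := PadicAlgCl ℓ)
      K.toSubalgebra.toSubmodule he hk hc2 hpn2 hqn2 hpqn2 hp02 hq02 hne2 hρ
    exact ⟨ρK, h0, h1, h⟩
  obtain ⟨ρ₂, hρ₂0, hρ₂⟩ := exists_pos_forall_of_antitoneP h𝒦fin.toFinset _
    (fun K m m' hm' hle hQ => ⟨hle.trans hQ.1, fun P h1 h2 h3 h4 h5 h6 => by
        obtain ⟨a, b, c⟩ := hQ.2 P h1 h2 h3 h4 h5 h6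
        exact ⟨hle.trans a, b.trans (inv_anti₀ hm' hle), hle.trans c⟩⟩) hperK
  refine ⟨ρ₂, hρ₂0, ?_⟩
  intro F _ _ hF x r hcurve hr hs hfar2 σ
  set t : F := r⁻¹ + (c : F) * r ^ k / (1 - 2 * x) with ht
  have hct : σ t = (σ r)⁻¹ + (c : _) * (σ r) ^ k / (1 - 2 * σ x) := map_tDeP σ c x r k
  have hcz : σ (aeval t p / aeval t q) = aeval (σ t) p / aeval (σ t) q := map_phiDeP σ p q t
  have hcurveσ : (σ r) ^ e = σ x * (1 - σ x) := by
    have := congrArg σ hcurve; simpa [map_pow, map_mul, map_sub, map_one] using this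
  have hrσ : σ r ≠ 0 := (map_ne_zero σ).mpr hr
  have hsσ : 1 - 2 * σ x ≠ 0 := by
    have := (map_ne_zero σ).mpr hs; simpa [map_sub, map_mul, map_one, map_ofNat] using this
  -- the subfield `K = ℚ_ℓ⟮σx⟯ ⊔ ℚ_ℓ⟮σr⟯`, of degree ≤ N * N
  let τ : F →ₐ[ℚ] PadicAlgCl ℓ := σ.toRatAlgHom
  have hint : ∀ y : F, IsIntegral ℚ_[ℓ] (σ y) := fun y => by
    have hQ : IsIntegral ℚ (σ y) := by
      rw [show σ y = τ y from rfl]; exact (Algebra.IsIntegral.isIntegral (R := ℚ) y).map τ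
    exact hQ.tower_top
  have hdegle : ∀ y : F, Module.finrank ℚ_[ℓ] (IntermediateField.adjoin ℚ_[ℓ]
      ({σ y} : Set (PadicAlgCl ℓ))) ≤ N := fun y => by
    have hQ : IsIntegral ℚ (σ y) := by
      rw [show σ y = τ y from rfl]; exact (Algebra.IsIntegral.isIntegral (R := ℚ) y).map τ
    rw [IntermediateField.adjoin.finrank (hint y)]
    have h1 : minpoly ℚ_[ℓ] (σ y) ∣ (minpoly ℚ (σ y)).map (algebraMap ℚ ℚ_[ℓ]) :=
      minpoly.dvd_map_of_isScalarTower ℚ ℚ_[ℓ] (σ y)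
    have hne' : (minpoly ℚ (σ y)).map (algebraMap ℚ ℚ_[ℓ]) ≠ 0 :=
      Polynomial.map_ne_zero (minpoly.ne_zero hQ)
    have h2 := Polynomial.natDegree_le_of_dvd h1 hne'
    rw [Polynomial.natDegree_map, show σ y = τ y from rfl, minpoly.algHom_eq τ σ.injective y] at h2
    exact h2.trans ((minpoly.natDegree_le y).trans hF)
  set Kx := IntermediateField.adjoin ℚ_[ℓ] ({σ x} : Set (PadicAlgCl ℓ)) with hKx
  set Kr := IntermediateField.adjoin ℚ_[ℓ] ({σ r} : Set (PadicAlgCl ℓ)) with hKr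
  haveI : FiniteDimensional ℚ_[ℓ] Kx := IntermediateField.adjoin.finiteDimensional (hint x)
  haveI : FiniteDimensional ℚ_[ℓ] Kr := IntermediateField.adjoin.finiteDimensional (hint r)
  set K := Kx ⊔ Kr with hK
  have hKfd : FiniteDimensional ℚ_[ℓ] K := IntermediateField.finiteDimensional_sup Kx Kr
  have hKdeg : Module.finrank ℚ_[ℓ] K ≤ N * N :=
    (IntermediateField.finrank_sup_le Kx Kr).trans (Nat.mul_le_mul (hdegle x) (hdegle r))
  have hKmem : K ∈ h𝒦fin.toFinset := by
    rw [Set.Finite.mem_toFinset]; exact ⟨hKfd, hKdeg⟩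
  have hxK : σ x ∈ K.toSubalgebra.toSubmodule :=
    (le_sup_left : Kx ≤ K) (IntermediateField.mem_adjoin_simple_self ℚ_[ℓ] _)
  have hrK : σ r ∈ K.toSubalgebra.toSubmodule :=
    (le_sup_right : Kr ≤ K) (IntermediateField.mem_adjoin_simple_self ℚ_[ℓ] _)
  obtain ⟨-, hKall⟩ := hρ₂ K hKmem
  have h := hKall (σ x, σ r) hxK hrK hcurveσ hrσ hsσ (fun P' h1 h2 h3 h4 => hfar2 σ P' h1 h2 h3
    ((fibre_aeval_iffP p q _).mpr h4))
  rw [← aeval_eq_eval_mapP, ← aeval_eq_eval_mapP] at h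
  rw [hcz, hct]
  exact h

end OnePrime

section Places

/-- **[GenEll] Thm 2.1 for `ℙ¹`, route piece W7 at a finite set of primes `S`** (family `t_c`,
`c ∈ ℚ^×`).  For every `ρ > 0`, degree bound `N` and finite set of primes `S` there is
`ρ' ∈ (0, 1/2]` such that for every number field `F` with `[F:ℚ] ≤ N` and every non-pole
`(x, r) ∈ D_e(F)` ALL of whose conjugates `(σx, σr)` — at `∞` and at every `ℓ ∈ S` — lie at
sup-distance `≥ ρ` from every non-pole curve point of the fibre `E_φ = φ_c⁻¹{0, 1, ∞}`, the point
`φ_c(x, r) = β(t_c(x, r)) ∈ F` satisfies `NFPoint.FarFromCusps S ρ'` (the `hZfar` of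
`GenEllPhiMechanismPlaces.vojtaIneq_of_belyi_mechanism_of_subset`).
[cite: MochizukiGenEll2010, Thm 2.1 p.12] -/
theorem exists_farFromCusps_phi_c_places {e k : ℕ} (he : 0 < e) (hk : 2 * k = e + 1) {c : ℚ}
    (hc : c ≠ 0) {p q : ℚ[X]} {n : ℕ} (hpn : p.natDegree = n) (hqn : q.natDegree = n)
    (hpqn : (p - q).natDegree = n) (hp0 : p ≠ 0) (hq0 : q ≠ 0) (hne : p ≠ q) {ρ : ℝ} (hρ : 0 < ρ)
    (N : ℕ) (S : Finset ℕ) (hS : ∀ ℓ ∈ S, ℓ.Prime) :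
    ∃ ρ' : ℝ, 0 < ρ' ∧ ρ' ≤ 1 / 2 ∧
      ∀ (F : Type) [Field F] [NumberField F], Module.finrank ℚ F ≤ N →
      ∀ (x r : F), r ^ e = x * (1 - x) → r ≠ 0 → 1 - 2 * x ≠ 0 →
      (∀ σ : F →+* ℂ, ∀ P' : ℂ × ℂ, P'.2 ^ e = P'.1 * (1 - P'.1) → P'.2 ≠ 0 → 1 - 2 * P'.1 ≠ 0 →
        (aeval (P'.2⁻¹ + (c : ℂ) * P'.2 ^ k / (1 - 2 * P'.1)) p = 0 ∨
          aeval (P'.2⁻¹ + (c : ℂ) * P'.2 ^ k / (1 - 2 * P'.1)) q = 0 ∨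
          aeval (P'.2⁻¹ + (c : ℂ) * P'.2 ^ k / (1 - 2 * P'.1)) (p - q) = 0) →
        ρ ≤ dist ((σ x, σ r) : ℂ × ℂ) P') →
      (∀ ℓ ∈ S, ∀ [Fact ℓ.Prime], ∀ σ : F →+* PadicAlgCl ℓ, ∀ P' : PadicAlgCl ℓ × PadicAlgCl ℓ,
        P'.2 ^ e = P'.1 * (1 - P'.1) → P'.2 ≠ 0 → 1 - 2 * P'.1 ≠ 0 →
        (aeval (P'.2⁻¹ + (c : PadicAlgCl ℓ) * P'.2 ^ k / (1 - 2 * P'.1)) p = 0 ∨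
          aeval (P'.2⁻¹ + (c : PadicAlgCl ℓ) * P'.2 ^ k / (1 - 2 * P'.1)) q = 0 ∨
          aeval (P'.2⁻¹ + (c : PadicAlgCl ℓ) * P'.2 ^ k / (1 - 2 * P'.1)) (p - q) = 0) →
        ρ ≤ dist ((σ x, σ r) : PadicAlgCl ℓ × PadicAlgCl ℓ) P') →
      NFPoint.FarFromCusps S ρ'
        ⟨F, aeval (r⁻¹ + (c : F) * r ^ k / (1 - 2 * x)) p /
          aeval (r⁻¹ + (c : F) * r ^ k / (1 - 2 * x)) q⟩ := by
  classical
  -- ARCHIMEDEAN constant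
  obtain ⟨hpnC, hqnC, hpqnC, hp0C, hq0C, hneC⟩ := mapped_hypsP (L := ℂ) hpn hqn hpqn hp0 hq0 hne
  have hcC : (c : ℂ) ≠ 0 := Rat.cast_ne_zero.mpr hc
  obtain ⟨ρ₁, hρ₁0, hρ₁1, harc⟩ := exists_annulus_of_far_fibre_c_of_properSpace (L := ℂ) he hk
    hcC hpnC hqnC hpqnC hp0C hq0C hneC hρ
  -- NONARCHIMEDEAN constants, one per prime of `S`, then their minimum
  have hper : ∀ ℓ ∈ S, ∃ m : ℝ, 0 < m ∧ ∀ [Fact ℓ.Prime],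
      ∀ (F : Type) [Field F] [NumberField F], Module.finrank ℚ F ≤ N →
      ∀ (x r : F), r ^ e = x * (1 - x) → r ≠ 0 → 1 - 2 * x ≠ 0 →
      (∀ σ : F →+* PadicAlgCl ℓ, ∀ P' : PadicAlgCl ℓ × PadicAlgCl ℓ,
        P'.2 ^ e = P'.1 * (1 - P'.1) → P'.2 ≠ 0 → 1 - 2 * P'.1 ≠ 0 →
        (aeval (P'.2⁻¹ + (c : PadicAlgCl ℓ) * P'.2 ^ k / (1 - 2 * P'.1)) p = 0 ∨
          aeval (P'.2⁻¹ + (c : PadicAlgCl ℓ) * P'.2 ^ k / (1 - 2 * P'.1)) q = 0 ∨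
          aeval (P'.2⁻¹ + (c : PadicAlgCl ℓ) * P'.2 ^ k / (1 - 2 * P'.1)) (p - q) = 0) →
        ρ ≤ dist ((σ x, σ r) : PadicAlgCl ℓ × PadicAlgCl ℓ) P') →
      ∀ σ : F →+* PadicAlgCl ℓ,
        m ≤ ‖σ (aeval (r⁻¹ + (c : F) * r ^ k / (1 - 2 * x)) p /
            aeval (r⁻¹ + (c : F) * r ^ k / (1 - 2 * x)) q)‖ ∧
        ‖σ (aeval (r⁻¹ + (c : F) * r ^ k / (1 - 2 * x)) p /
            aeval (r⁻¹ + (c : F) * r ^ k / (1 - 2 * x)) q)‖ ≤ m⁻¹ ∧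
        m ≤ ‖σ (aeval (r⁻¹ + (c : F) * r ^ k / (1 - 2 * x)) p /
            aeval (r⁻¹ + (c : F) * r ^ k / (1 - 2 * x)) q) - 1‖ := by
    intro ℓ hℓ
    haveI : Fact ℓ.Prime := ⟨hS ℓ hℓ⟩
    obtain ⟨ρK, h0, h⟩ := exists_padicAnnulus_phi_c ℓ he hk hc hpn hqn hpqn hp0 hq0 hne hρ N
    exact ⟨ρK, h0, fun F _ _ hF x r hcurve hr hs hfar σ => h F hF x r hcurve hr hs hfar σ⟩
  choose! m hm0 hm using hper
  -- the minimum over `S` (or `1` if `S = ∅`)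
  obtain ⟨ρ₂, hρ₂0, hρ₂le⟩ : ∃ ρ₂ : ℝ, 0 < ρ₂ ∧ ∀ ℓ ∈ S, ρ₂ ≤ m ℓ := by
    by_cases hSne : S.Nonempty
    · obtain ⟨ℓ₀, hℓ₀, heq⟩ := Finset.exists_mem_eq_inf' hSne m
      exact ⟨S.inf' hSne m, by rw [heq]; exact hm0 ℓ₀ hℓ₀, fun ℓ hℓ => Finset.inf'_le m hℓ⟩
    · exact ⟨1, one_pos, fun ℓ hℓ => absurd ⟨ℓ, hℓ⟩ hSne⟩
  -- the uniform constant
  refine ⟨min (1 / 2) (min (ρ₁ / 2) ρ₂), by positivity, min_le_left _ _, ?_⟩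
  intro F _ _ hF x r hcurve hr hs hfarC hfarS
  set t : F := r⁻¹ + (c : F) * r ^ k / (1 - 2 * x) with ht
  constructor
  · -- archimedean conjugates: STRICT inequalities from ρ₁/2 < ρ₁
    intro σ
    have hct : σ t = (σ r)⁻¹ + (c : _) * (σ r) ^ k / (1 - 2 * σ x) := map_tDeP σ c x r k
    have hcz : σ (aeval t p / aeval t q) = aeval (σ t) p / aeval (σ t) q := map_phiDeP σ p q t
    have hcurveσ : (σ r) ^ e = σ x * (1 - σ x) := by
      have := congrArg σ hcurve; simpa [map_pow, map_mul, map_sub, map_one] using this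
    have hrσ : σ r ≠ 0 := (map_ne_zero σ).mpr hr
    have hsσ : 1 - 2 * σ x ≠ 0 := by
      have := (map_ne_zero σ).mpr hs; simpa [map_sub, map_mul, map_one, map_ofNat] using this
    have h := harc (σ x, σ r) hcurveσ hrσ hsσ (fun P' h1 h2 h3 h4 => hfarC σ P' h1 h2 h3
      ((fibre_aeval_iffP p q _).mpr h4))
    rw [← aeval_eq_eval_mapP, ← aeval_eq_eval_mapP] at h
    obtain ⟨ha, hb, hc'⟩ := h
    change min (1 / 2) (min (ρ₁ / 2) ρ₂) < ‖σ (aeval t p / aeval t q)‖ ∧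
      ‖σ (aeval t p / aeval t q)‖ < (min (1 / 2) (min (ρ₁ / 2) ρ₂))⁻¹ ∧
      min (1 / 2) (min (ρ₁ / 2) ρ₂) < ‖σ (aeval t p / aeval t q) - 1‖
    rw [hcz, hct]
    have hm : min (1 / 2) (min (ρ₁ / 2) ρ₂) ≤ ρ₁ / 2 := (min_le_right _ _).trans (min_le_left _ _)
    have hlt : ρ₁ / 2 < ρ₁ := by linarith
    refine ⟨lt_of_le_of_lt hm (lt_of_lt_of_le hlt ha), lt_of_le_of_lt hb ?_,
      lt_of_le_of_lt hm (lt_of_lt_of_le hlt hc')⟩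
    exact inv_strictAnti₀ (by positivity) (lt_of_le_of_lt hm hlt)
  · -- ℓ-adic conjugates, ℓ ∈ S
    intro ℓ hℓ inst σ
    obtain ⟨ha, hb, hc'⟩ := hm ℓ hℓ F hF x r hcurve hr hs (hfarS ℓ hℓ) σ
    have hmle : min (1 / 2) (min (ρ₁ / 2) ρ₂) ≤ m ℓ :=
      ((min_le_right _ _).trans (min_le_right _ _)).trans (hρ₂le ℓ hℓ)
    exact ⟨hmle.trans ha, hb.trans (inv_anti₀ (by positivity) hmle), hmle.trans hc'⟩

/-- **W7 at a finite set of primes, `x`-coordinate form**: it suffices that every conjugate `σx`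
be `ρ`-far from the `x`-COORDINATES of the fibre points, at `∞` and at every `ℓ ∈ S`.
[cite: MochizukiGenEll2010, Thm 2.1 p.12] -/
theorem exists_farFromCusps_phi_c_places_of_x_far {e k : ℕ} (he : 0 < e) (hk : 2 * k = e + 1)
    {c : ℚ} (hc : c ≠ 0) {p q : ℚ[X]} {n : ℕ} (hpn : p.natDegree = n) (hqn : q.natDegree = n)
    (hpqn : (p - q).natDegree = n) (hp0 : p ≠ 0) (hq0 : q ≠ 0) (hne : p ≠ q) {ρ : ℝ} (hρ : 0 < ρ)
    (N : ℕ) (S : Finset ℕ) (hS : ∀ ℓ ∈ S, ℓ.Prime) :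
    ∃ ρ' : ℝ, 0 < ρ' ∧ ρ' ≤ 1 / 2 ∧
      ∀ (F : Type) [Field F] [NumberField F], Module.finrank ℚ F ≤ N →
      ∀ (x r : F), r ^ e = x * (1 - x) → r ≠ 0 → 1 - 2 * x ≠ 0 →
      (∀ σ : F →+* ℂ, ∀ P' : ℂ × ℂ, P'.2 ^ e = P'.1 * (1 - P'.1) → P'.2 ≠ 0 → 1 - 2 * P'.1 ≠ 0 →
        (aeval (P'.2⁻¹ + (c : ℂ) * P'.2 ^ k / (1 - 2 * P'.1)) p = 0 ∨
          aeval (P'.2⁻¹ + (c : ℂ) * P'.2 ^ k / (1 - 2 * P'.1)) q = 0 ∨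
          aeval (P'.2⁻¹ + (c : ℂ) * P'.2 ^ k / (1 - 2 * P'.1)) (p - q) = 0) →
        ρ ≤ ‖σ x - P'.1‖) →
      (∀ ℓ ∈ S, ∀ [Fact ℓ.Prime], ∀ σ : F →+* PadicAlgCl ℓ, ∀ P' : PadicAlgCl ℓ × PadicAlgCl ℓ,
        P'.2 ^ e = P'.1 * (1 - P'.1) → P'.2 ≠ 0 → 1 - 2 * P'.1 ≠ 0 →
        (aeval (P'.2⁻¹ + (c : PadicAlgCl ℓ) * P'.2 ^ k / (1 - 2 * P'.1)) p = 0 ∨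
          aeval (P'.2⁻¹ + (c : PadicAlgCl ℓ) * P'.2 ^ k / (1 - 2 * P'.1)) q = 0 ∨
          aeval (P'.2⁻¹ + (c : PadicAlgCl ℓ) * P'.2 ^ k / (1 - 2 * P'.1)) (p - q) = 0) →
        ρ ≤ ‖σ x - P'.1‖) →
      NFPoint.FarFromCusps S ρ'
        ⟨F, aeval (r⁻¹ + (c : F) * r ^ k / (1 - 2 * x)) p /
          aeval (r⁻¹ + (c : F) * r ^ k / (1 - 2 * x)) q⟩ := by
  obtain ⟨ρ', h0, h1, h⟩ :=
    exists_farFromCusps_phi_c_places he hk hc hpn hqn hpqn hp0 hq0 hne hρ N S hS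
  refine ⟨ρ', h0, h1, fun F _ _ hF x r hcurve hr hs hC hS' => h F hF x r hcurve hr hs ?_ ?_⟩
  · intro σ P' h1' h2' h3' h4'
    calc ρ ≤ ‖σ x - P'.1‖ := hC σ P' h1' h2' h3' h4'
      _ = dist ((σ x, σ r) : ℂ × ℂ).1 P'.1 := (dist_eq_norm _ _).symm
      _ ≤ dist ((σ x, σ r) : ℂ × ℂ) P' := by rw [Prod.dist_eq]; exact le_max_left _ _
  · intro ℓ hℓ inst σ P' h1' h2' h3' h4'
    calc ρ ≤ ‖σ x - P'.1‖ := hS' ℓ hℓ σ P' h1' h2' h3' h4'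
      _ = dist ((σ x, σ r) : PadicAlgCl ℓ × PadicAlgCl ℓ).1 P'.1 := (dist_eq_norm _ _).symm
      _ ≤ dist ((σ x, σ r) : PadicAlgCl ℓ × PadicAlgCl ℓ) P' := by
          rw [Prod.dist_eq]; exact le_max_left _ _

end Places

end Literature.NumberTheory.DiophantineGeometry.GenEll
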